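import Summits.AtomisticToContinuum.BoseEinsteinCondensation.Theses.BECRichardsonGaudin

/-!
# Route `BECRichardsonGaudin`, assembly item `Assembly` (stmt-AtomisticToContinuum-14807)

Settles the assembly item `stmt-AtomisticToContinuum-14807` of route
`route-AtomisticToContinuum-BECRichardsonGaudin`: the implication

  `RichardsonAnchorBEC → BeliaevDeformationBound → SingularPotentialPeriodicBEC →
    BoundaryTransferWeak → BoseEinsteinCondensation`

(the audited sub-problem abbrev `_root_.BoseEinsteinCondensation`, by name). Its hypotheses are,
verbatim and in the same order, those of the route's deciding theorem
`Summit.AtomisticToContinuum.BoseEinsteinCondensation.Theses.BECRichardsonGaudin.closes` (planner-authored,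
elaborating with the route file): for a repulsive finite-range `v`, either `∫ v = ∞` and
`SingularPotentialPeriodicBEC` gives the periodic-BEC body, or `∫ v < ∞` and the anchor theorem
(`RichardsonAnchorBEC`, ε = 1/4) with the comparison (`BeliaevDeformationBound`, Λ = 1, ε = 1/4) give
constant-mode condensation `≥ N/2` of near-minimisers on the torus; `BoundaryTransferWeak` carries either
body to `HasGroundStateBEC v ρ` for small `ρ`. So the assembly is `closes`, curried; no analytic content
lives here (the open content is in the cruxes: `BeliaevDeformationBound` is equivalent to complete
condensation of the soft periodic gas, `Theorems/BECRichardsonGaudinBeliaevDeformationBoundCompleteCondensation.lean`).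

References: [LSSY2005, §1.2 (1.16)–(1.19) and Ch. 5] (the conjunct being assembled).
-/

namespace Summit.AtomisticToContinuum.BoseEinsteinCondensation.Theorems

/-- **Item stmt-AtomisticToContinuum-14807** (`Assembly` of route `BECRichardsonGaudin`, exact route
decl): `RichardsonAnchorBEC → BeliaevDeformationBound → SingularPotentialPeriodicBEC →
BoundaryTransferWeak → BoseEinsteinCondensation` is the route's deciding theorem `closes` (by cases on
`∫ v = ∞`; in the integrable case ranks 3 + 2 with `ε = 1/4` twice give condensation `≥ N/2`, then the
boundary transfer). Pure composition. [folklore] -/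
theorem becRichardsonGaudin_assembly_proof :
    Summit.AtomisticToContinuum.BoseEinsteinCondensation.Theses.BECRichardsonGaudin.Assembly := by
  unfold Theses.BECRichardsonGaudin.Assembly
  intro hA hB hS hT
  exact Theses.BECRichardsonGaudin.closes hA hB hS hT

end Summit.AtomisticToContinuum.BoseEinsteinCondensation.Theorems
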